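import Summits.ResolutionOfSingularities.ResolutionOfSingularities.Theorems.PAlterationPialtPiEngine
import Summits.ResolutionOfSingularities.ResolutionOfSingularities.Theorems.PAlterationPialtConclusionOfRegularPiModel
import Summits.ResolutionOfSingularities.ResolutionOfSingularities.Theorems.PAlterationPialtNormalProjective
import Literature.AlgebraicGeometry.Resolution.FieldsJ2
import HarnessLib

/-!
# Crux `Pialt` (stmt-ResolutionOfSingularities-0555), PiTMP programme: ASSEMBLY — `Temkin2013 ∧ PiTMP ⟹ Pialt`

Line lead c5 (prover-line-stmt-ResolutionOfSingularities-0555-c5-0, 2026-08-17).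

* `pialtConclusion_of_temkin2013_of_piTwoModelPatching` — for a NORMAL integral projective `X` over a field `k` of
  characteristic `p`: `Temkin2013` and `PiTMP_p` at `k` give the conclusion of the crux at `X` (engine
  `exists_regular_piModel_of_temkin2013_of_piTwoModelPatching` on `X` as a projective model of its function field,
  then `pialtConclusion_of_regular_piModel`).
* `pialt_of_temkin2013_piTwoModelPatching` — **`Temkin2013 → (∀ p, p.Prime → PiTMP_p) → Pialt`** (reduction to
  normal projective `X`, field by field: `pialtConclusion_of_forall_normal_isProjectiveOver`). The hypothesis
  `PiTMP_p` is VERBATIM the registered stub `stub_piTwoModelPatching`; with the exactness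
  `piTwoModelPatching_of_pialt` (same programme) this makes **`Pialt ⟺ ∀ p, PiTMP_p` modulo the published theorem
  `Temkin2013`** — a ONE-atom, crux-exact residual of the Abramovich–Oort conjecture in characteristic `p`.

References: O. Piltant, RACSAM 107 (2013), Prop. 5.1, Cor. 5.7; M. Temkin, J. Algebra 373 (2013), Conj. 1.3.1,
Thm. 1.3.2, §1.3.
-/

set_option linter.dupNamespace false

noncomputable section

open CategoryTheory AlgebraicGeometry IsLocalRing
open Literature.AlgebraicGeometry.Resolution Literature.AlgebraicGeometry
open Summit.ResolutionOfSingularities.ResolutionOfSingularities.Theses.PAlteration (Pialt)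

namespace Summit.ResolutionOfSingularities.ResolutionOfSingularities.Theorems.Pialt.PiPatching

/-- **The conclusion of the crux at a normal integral projective `X` from `Temkin2013` and purely inseparable
two-model patching at the ground field.** [cite: Piltant2013, Prop. 5.1 and Cor. 5.7] [cite: Temkin2013, Thm. 1.3.2] -/
theorem pialtConclusion_of_temkin2013_of_piTwoModelPatching {p : ℕ} [Fact p.Prime] (hT : Temkin2013.{0})
    (k : Type) [Field k] [CharP k p]
    (hZ : ∀ (K : Type) [Field K] [Algebra k K]
      (L₁ : Type) [Field L₁] [Algebra K L₁] [Algebra k L₁] [IsScalarTower k K L₁]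
      [FiniteDimensional K L₁] [IsPurelyInseparable K L₁]
      (L₂ : Type) [Field L₂] [Algebra K L₂] [Algebra k L₂] [IsScalarTower k K L₂]
      [FiniteDimensional K L₂] [IsPurelyInseparable K L₂]
      (M₁ : ProperModel k L₁) (M₂ : ProperModel k L₂),
      ∃ (L : Type) (_ : Field L) (_ : Algebra K L) (_ : Algebra k L) (_ : IsScalarTower k K L)
        (ι₁ : L₁ →ₐ[K] L) (ι₂ : L₂ →ₐ[K] L),
        FiniteDimensional K L ∧ IsPurelyInseparable K L ∧
        ∃ (N : ProperModel k L) (φ₁ : N.X ⟶ M₁.X) (φ₂ : N.X ⟶ M₂.X),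
          φ₁ ≫ M₁.π = N.π ∧ φ₂ ≫ M₂.π = N.π ∧
          N.gen ≫ φ₁ = Spec.map (CommRingCat.ofHom ι₁.toRingHom) ≫ M₁.gen ∧
          N.gen ≫ φ₂ = Spec.map (CommRingCat.ofHom ι₂.toRingHom) ≫ M₂.gen ∧
          ∀ n : N.X, (IsRegularLocalRing (M₁.X.presheaf.stalk (φ₁.base n)) ∨
              IsRegularLocalRing (M₂.X.presheaf.stalk (φ₂.base n))) →
            IsRegularLocalRing (N.X.presheaf.stalk n))
    (X : Scheme.{0}) [IsIntegral X] (πX : X ⟶ Spec (.of k))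
    (hproj : Motives.IsProjectiveOver (Over.mk πX))
    (hnorm : ∀ x : X, IsIntegrallyClosed (X.presheaf.stalk x)) :
    ∃ (X' : Scheme.{0}) (g : X' ⟶ X), IsProper g ∧ IsIntegral X' ∧ Scheme.IsRegular X' ∧
      Function.Surjective g.base ∧ ∃ U : X.Opens, Dense (U : Set X) ∧ IsFinite (g ∣_ U) ∧
        UniversallyInjective (g ∣_ U) := by
  classical
  haveI : IsProper πX := Motives.IsProjectiveOver.isProper hproj
  -- an affine chart `U = Spec A` of `X`
  obtain ⟨_, ⟨U', hU', rfl⟩, hηU, -⟩ := X.isBasis_affineOpens.exists_subset_of_mem_open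
    (Set.mem_univ (genericPoint X)) isOpen_univ
  let U : X.Opens := U'
  have hU : IsAffineOpen U := hU'
  haveI : IsAffine U := hU
  haveI : Nonempty U := ⟨⟨_, hηU⟩⟩
  let A : Type := Γ(U, ⊤)
  -- `A` is a finitely generated `k`-algebra
  let g : (U : Scheme.{0}) ⟶ Spec (.of k) := U.ι ≫ πX
  let ψ : k →+* A := g.appTop.hom.comp (Scheme.ΓSpecIso (.of k)).inv.hom
  have hψ : ψ.FiniteType := by
    have h1 : g.appTop.hom.FiniteType :=
      (HasRingHomProperty.iff_of_isAffine (P := @LocallyOfFiniteType)).mp inferInstance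
    exact h1.comp (RingHom.FiniteType.of_surjective _
      (Scheme.ΓSpecIso (.of k)).symm.commRingCatIsoToRingEquiv.surjective)
  letI : Algebra k A := ψ.toAlgebra
  haveI hft : Algebra.FiniteType k A := hψ
  -- its fraction field `K`, and `X` as a projective model of `K/k`
  let K : Type := FractionRing A
  let j : Spec (.of A) ⟶ X := U.toScheme.isoSpec.inv ≫ U.ι
  have hj : j ≫ πX = Spec.map (CommRingCat.ofHom (algebraMap k A)) := by
    change (U.toScheme.isoSpec.inv ≫ U.ι) ≫ πX = Spec.map (CommRingCat.ofHom ψ)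
    rw [Category.assoc, isoSpec_inv_comp]
    rfl
  let M₀ : ProjModel k K := ProjModel.ofChart (K := K) X πX hproj A j hj
  have hKfg : (⊤ : IntermediateField k K).FG :=
    IntermediateField.fg_top_of_isFractionRing_of_finiteType k A K
  -- the engine: a regular purely inseparable model dominating `X`
  obtain ⟨L, _, _, _, _, hfin, hpi, N, φ, hφπ, hφgen, hreg⟩ :=
    exists_regular_piModel_of_temkin2013_of_piTwoModelPatching hT k hZ K hKfg M₀.toProperModel
  -- conversion into the conclusion of the crux
  exact RadiciallyRegular.pialtConclusion_of_regular_piModel p k K L M₀.toProperModel N hnorm φ hφπ hφgen hreg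

/-- **`Pialt` from `Temkin2013` and purely inseparable two-model patching in every prime characteristic.** The
second hypothesis is VERBATIM the registered stub `stub_piTwoModelPatching`; with `piTwoModelPatching_of_pialt` it
follows that, modulo Temkin's inseparable local uniformization theorem (Temkin 2013, Thm. 1.3.2), the
Abramovich–Oort conjecture in characteristic `p` is EQUIVALENT to purely inseparable two-model patching.
[cite: Temkin2013, Conj. 1.3.1 and Thm. 1.3.2] [cite: Piltant2013, Prop. 5.1] -/
theorem pialt_of_temkin2013_piTwoModelPatching (hT : Temkin2013.{0})
    (hZ : ∀ p : ℕ, p.Prime → ∀ (k : Type) [Field k] [CharP k p] (K : Type) [Field K] [Algebra k K]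
      (L₁ : Type) [Field L₁] [Algebra K L₁] [Algebra k L₁] [IsScalarTower k K L₁]
      [FiniteDimensional K L₁] [IsPurelyInseparable K L₁]
      (L₂ : Type) [Field L₂] [Algebra K L₂] [Algebra k L₂] [IsScalarTower k K L₂]
      [FiniteDimensional K L₂] [IsPurelyInseparable K L₂]
      (M₁ : ProperModel k L₁) (M₂ : ProperModel k L₂),
      ∃ (L : Type) (_ : Field L) (_ : Algebra K L) (_ : Algebra k L) (_ : IsScalarTower k K L)
        (ι₁ : L₁ →ₐ[K] L) (ι₂ : L₂ →ₐ[K] L),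
        FiniteDimensional K L ∧ IsPurelyInseparable K L ∧
        ∃ (N : ProperModel k L) (φ₁ : N.X ⟶ M₁.X) (φ₂ : N.X ⟶ M₂.X),
          φ₁ ≫ M₁.π = N.π ∧ φ₂ ≫ M₂.π = N.π ∧
          N.gen ≫ φ₁ = Spec.map (CommRingCat.ofHom ι₁.toRingHom) ≫ M₁.gen ∧
          N.gen ≫ φ₂ = Spec.map (CommRingCat.ofHom ι₂.toRingHom) ≫ M₂.gen ∧
          ∀ n : N.X, (IsRegularLocalRing (M₁.X.presheaf.stalk (φ₁.base n)) ∨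
              IsRegularLocalRing (M₂.X.presheaf.stalk (φ₂.base n))) →
            IsRegularLocalRing (N.X.presheaf.stalk n)) :
    Pialt := by
  rw [pialt_iff_forall_normal_isProjectiveOver]
  intro p hp k _ _ X f hi hproj hN
  haveI : Fact p.Prime := ⟨hp⟩
  haveI := hi
  exact pialtConclusion_of_temkin2013_of_piTwoModelPatching hT k (hZ p hp k) X f hproj hN

end Summit.ResolutionOfSingularities.ResolutionOfSingularities.Theorems.Pialt.PiPatching

end
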